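import Summits.RiemannHypothesis.RiemannHypothesis.Theorems.PfPersistenceEdgeLawCuspScale

/-!
# Edge law — the cusp coordinate of a window (RH-free calculus)

Part of the pub-rhpf THEORY-2 programme (mechanism / rigidity of the Weil window bottom; no RH
claims). The **cusp coordinate** of the window `[-a, a]` is
`cuspCoord a y = sign(y) (cuspPrim a a − cuspPrim a (a − |y|))`: odd, increasing, with derivative
the cusp weight `cuspWeight a (a − |y|)`, modulus `cuspCoord a y − cuspCoord a x ≤ 2 cuspPrim a (y − x)`
and slope `≤ (y − x) cuspWeight a (a − y)` on `0 ≤ x ≤ y < a`. A function which is Lipschitz in the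
cusp coordinate is the RH-free regularity hypothesis under which the interior dilation defect of a
Weil ground state is `o(η)` (`PfPersistenceEdgeLawCuspDefect`).

Sources: E. Bombieri, *Remarks on Weil's quadratic functional in the theory of prime numbers I*,
Rend. Mat. Acc. Lincei (9) 11 (2000) §4; X. Ros-Oton, J. Serra, J. Math. Pures Appl. 101 (2014)
Thm 1.2 (the model boundary gradient bound).
-/

set_option linter.dupNamespace false

noncomputable section

open MeasureTheory Set Filter
open scoped Topology

namespace Summit.RiemannHypothesis.RiemannHypothesis.Theorems.PfPersistence

/-! ## The cusp coordinate -/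

/-- The **cusp coordinate** `Γ_a(y) = sign(y) (G_a(a) − G_a(a − |y|))` of the window `[-a, a]`.
[folklore] -/
def cuspCoord (a y : ℝ) : ℝ :=
  if 0 ≤ y then cuspPrim a a - cuspPrim a (a - y) else cuspPrim a (a + y) - cuspPrim a a

/-- `Γ_a(y) = G_a(a) − G_a(a − y)` for `y ≥ 0`. [folklore] -/
theorem cuspCoord_of_nonneg (a : ℝ) {y : ℝ} (hy : 0 ≤ y) :
    cuspCoord a y = cuspPrim a a - cuspPrim a (a - y) := by
  rw [cuspCoord, if_pos hy]

/-- `Γ_a(y) = G_a(a + y) − G_a(a)` for `y ≤ 0`. [folklore] -/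
theorem cuspCoord_of_nonpos (a : ℝ) {y : ℝ} (hy : y ≤ 0) :
    cuspCoord a y = cuspPrim a (a + y) - cuspPrim a a := by
  rcases hy.eq_or_lt with h | h
  · subst h
    simp [cuspCoord]
  · rw [cuspCoord, if_neg (not_le.2 h)]

/-- `Γ_a(0) = 0`. [folklore] -/
theorem cuspCoord_zero (a : ℝ) : cuspCoord a 0 = 0 := by
  rw [cuspCoord_of_nonneg a le_rfl, sub_zero, sub_self]

/-- `Γ_a(a) = G_a(a)` (`a ≥ 0`). [folklore] -/
theorem cuspCoord_self {a : ℝ} (ha : 0 ≤ a) : cuspCoord a a = cuspPrim a a := by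
  rw [cuspCoord_of_nonneg a ha, sub_self, cuspPrim_zero, sub_zero]

/-- `Γ_a(−a) = −G_a(a)` (`a ≥ 0`). [folklore] -/
theorem cuspCoord_neg_self {a : ℝ} (ha : 0 ≤ a) : cuspCoord a (-a) = -cuspPrim a a := by
  rw [cuspCoord_of_nonpos a (neg_nonpos.2 ha), add_neg_cancel, cuspPrim_zero, zero_sub]

/-- `Γ_a` is odd. [folklore] -/
theorem cuspCoord_neg (a y : ℝ) : cuspCoord a (-y) = -cuspCoord a y := by
  rcases le_total 0 y with hy | hy
  · rw [cuspCoord_of_nonpos a (neg_nonpos.2 hy), cuspCoord_of_nonneg a hy, ← sub_eq_add_neg]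
    ring
  · rw [cuspCoord_of_nonneg a (neg_nonneg.2 hy), cuspCoord_of_nonpos a hy, sub_neg_eq_add]
    ring

/-- `0 ≤ Γ_a(y) ≤ G_a(a)` hold on `[0, a]`: the lower bound. [folklore] -/
theorem cuspCoord_nonneg {a y : ℝ} (hy : 0 ≤ y) (hya : y ≤ a) : 0 ≤ cuspCoord a y := by
  rw [cuspCoord_of_nonneg a hy, sub_nonneg]
  exact cuspPrim_mono (by linarith) (by linarith) le_rfl

/-- `Γ_a(y) ≤ G_a(a)` for `−a ≤ y`. [folklore] -/
theorem cuspCoord_le {a y : ℝ} (hy : -a ≤ y) : cuspCoord a y ≤ cuspPrim a a := by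
  rcases le_total 0 y with h | h
  · rw [cuspCoord_of_nonneg a h, sub_le_self_iff]
    exact cuspPrim_nonneg _ _
  · rw [cuspCoord_of_nonpos a h, sub_le_iff_le_add]
    have := cuspPrim_mono (by linarith : 0 ≤ a + y) (by linarith : a + y ≤ a) le_rfl
    linarith [cuspPrim_nonneg a a]

/-- `−G_a(a) ≤ Γ_a(y)` for `y ≤ a`. [folklore] -/
theorem neg_le_cuspCoord {a y : ℝ} (hya : y ≤ a) : -cuspPrim a a ≤ cuspCoord a y := by
  have h := cuspCoord_le (a := a) (y := -y) (by linarith)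
  rw [cuspCoord_neg] at h
  linarith

/-- `Γ_a(x) ≤ 0` for `−a ≤ x ≤ 0`. [folklore] -/
theorem cuspCoord_nonpos {a x : ℝ} (hx : -a ≤ x) (hx0 : x ≤ 0) : cuspCoord a x ≤ 0 := by
  have h := cuspCoord_nonneg (neg_nonneg.2 hx0) (by linarith : -x ≤ a)
  rw [cuspCoord_neg] at h
  linarith

/-- `Γ_a` is monotone on `[-a, a]`. [folklore] -/
theorem cuspCoord_mono {a x y : ℝ} (hx : -a ≤ x) (hxy : x ≤ y) (hya : y ≤ a) :
    cuspCoord a x ≤ cuspCoord a y := by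
  rcases le_total 0 x with h0x | hx0
  · rw [cuspCoord_of_nonneg a h0x, cuspCoord_of_nonneg a (h0x.trans hxy)]
    have := cuspPrim_mono (a := a) (by linarith : 0 ≤ a - y) (by linarith : a - y ≤ a - x)
      (by linarith)
    linarith
  rcases le_total 0 y with h0y | hy0
  · exact (cuspCoord_nonpos hx hx0).trans (cuspCoord_nonneg h0y hya)
  · rw [cuspCoord_of_nonpos a hx0, cuspCoord_of_nonpos a hy0]
    have := cuspPrim_mono (a := a) (by linarith : 0 ≤ a + x) (by linarith : a + x ≤ a + y)
      (by linarith)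
    linarith

/-- **Modulus of the cusp coordinate**: `Γ_a(y) − Γ_a(x) ≤ 2 G_a(y − x)` for
`−a ≤ x ≤ y ≤ a`, `y − x ≤ a` (sub-additivity of `G_a`). [folklore] -/
theorem cuspCoord_sub_le {a x y : ℝ} (hx : -a ≤ x) (hxy : x ≤ y) (hya : y ≤ a) (hd : y - x ≤ a) :
    cuspCoord a y - cuspCoord a x ≤ 2 * cuspPrim a (y - x) := by
  have hG0 := cuspPrim_nonneg a (y - x)
  rcases le_total 0 x with h0x | hx0
  · -- both on the right: `G(a − x) − G(a − y) ≤ G(y − x)`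
    rw [cuspCoord_of_nonneg a h0x, cuspCoord_of_nonneg a (h0x.trans hxy)]
    have h := cuspPrim_add_sub_le (by linarith : 0 ≤ a - y) (by linarith : 0 ≤ y - x)
      (by linarith : a - y + (y - x) ≤ a)
    rw [show a - y + (y - x) = a - x by ring] at h
    linarith
  rcases le_total 0 y with h0y | hy0
  · -- straddling `0`: `Γ(y) ≤ G(y) ≤ G(y − x)`, `−Γ(x) ≤ G(−x) ≤ G(y − x)`
    rw [cuspCoord_of_nonneg a h0y, cuspCoord_of_nonpos a hx0]
    have h1 := cuspPrim_add_sub_le (by linarith : 0 ≤ a - y) h0y (by linarith : a - y + y ≤ a)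
    rw [show a - y + y = a by ring] at h1
    have h2 := cuspPrim_add_sub_le (by linarith : 0 ≤ a + x) (neg_nonneg.2 hx0)
      (by linarith : a + x + -x ≤ a)
    rw [show a + x + -x = a by ring] at h2
    have h3 := cuspPrim_mono h0y (by linarith : y ≤ y - x) hd
    have h4 := cuspPrim_mono (neg_nonneg.2 hx0) (by linarith : -x ≤ y - x) hd
    linarith
  · -- both on the left: `G(a + y) − G(a + x) ≤ G(y − x)`
    rw [cuspCoord_of_nonpos a hx0, cuspCoord_of_nonpos a hy0]
    have h := cuspPrim_add_sub_le (by linarith : 0 ≤ a + x) (by linarith : 0 ≤ y - x)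
      (by linarith : a + x + (y - x) ≤ a)
    rw [show a + x + (y - x) = a + y by ring] at h
    linarith

/-- **Slope of the cusp coordinate** on the right half: `Γ_a(y) − Γ_a(x) ≤ (y − x) ψ_a(a − y)` for
`0 ≤ x ≤ y < a`. [folklore] -/
theorem cuspCoord_sub_le_mul {a x y : ℝ} (h0x : 0 ≤ x) (hxy : x ≤ y) (hya : y < a) :
    cuspCoord a y - cuspCoord a x ≤ (y - x) * cuspWeight a (a - y) := by
  rw [cuspCoord_of_nonneg a h0x, cuspCoord_of_nonneg a (h0x.trans hxy)]
  have h := cuspPrim_sub_le_mul (by linarith : 0 < a - y) (by linarith : a - y ≤ a - x)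
    (by linarith : a - x ≤ a)
  rw [show a - x - (a - y) = y - x by ring] at h
  linarith

/-- `HasDerivAt Γ_a (ψ_a(a − |y|)) y` at every `|y| < a`. [folklore] -/
theorem hasDerivAt_cuspCoord {a y : ℝ} (hy : |y| < a) :
    HasDerivAt (cuspCoord a) (cuspWeight a (a - |y|)) y := by
  obtain ⟨hya1, hya2⟩ := abs_lt.1 hy
  have ha : 0 < a := (abs_nonneg y).trans_lt hy
  -- right branch `R(z) = G(a) − G(a − z)` (`0 ≤ z < a`), left branch `L(z) = G(a + z) − G(a)`
  have hR : ∀ z, 0 ≤ z → z < a → HasDerivAt (fun z ↦ cuspPrim a a - cuspPrim a (a - z))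
      (cuspWeight a (a - z)) z := fun z hz1 hz2 ↦ by
    have h1 : HasDerivAt (fun z ↦ a - z) (-1) z := by
      simpa using (hasDerivAt_id z).const_sub a
    have h2 := ((hasDerivAt_cuspPrim (by linarith : 0 < a - z) (by linarith : a - z ≤ a)).comp z
      h1).const_sub (cuspPrim a a)
    exact h2.congr_deriv (by simp)
  have hL : ∀ z, -a < z → z ≤ 0 → HasDerivAt (fun z ↦ cuspPrim a (a + z) - cuspPrim a a)
      (cuspWeight a (a + z)) z := fun z hz1 hz2 ↦ by
    have h1 : HasDerivAt (fun z ↦ a + z) 1 z := by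
      simpa using (hasDerivAt_id z).const_add a
    have h2 := ((hasDerivAt_cuspPrim (by linarith : 0 < a + z) (by linarith : a + z ≤ a)).comp z
      h1).sub_const (cuspPrim a a)
    exact h2.congr_deriv (by simp)
  rcases lt_trichotomy 0 y with h0y | h0y | hy0
  · rw [abs_of_pos h0y]
    refine (hR y h0y.le hya2).congr_of_eventuallyEq ?_
    filter_upwards [Ioi_mem_nhds h0y] with z hz
    exact cuspCoord_of_nonneg a (le_of_lt hz)
  · subst h0y
    rw [abs_zero, sub_zero]
    have h1 : HasDerivWithinAt (cuspCoord a) (cuspWeight a a) (Ici 0) 0 := by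
      have h := (hR 0 le_rfl ha).hasDerivWithinAt (s := Ici 0)
      rw [sub_zero] at h
      exact h.congr (fun z hz ↦ cuspCoord_of_nonneg a hz) (cuspCoord_of_nonneg a le_rfl)
    have h2 : HasDerivWithinAt (cuspCoord a) (cuspWeight a a) (Iic 0) 0 := by
      have h := (hL 0 (by linarith) le_rfl).hasDerivWithinAt (s := Iic 0)
      rw [add_zero] at h
      exact h.congr (fun z hz ↦ cuspCoord_of_nonpos a hz) (cuspCoord_of_nonpos a le_rfl)
    have h3 := h2.union h1
    rwa [Iic_union_Ici, hasDerivWithinAt_univ] at h3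
  · rw [abs_of_neg hy0, sub_neg_eq_add]
    refine (hL y hya1 hy0.le).congr_of_eventuallyEq ?_
    filter_upwards [Iio_mem_nhds hy0] with z hz
    exact cuspCoord_of_nonpos a (le_of_lt hz)

/-- `Γ_a` is continuous on the open window. [folklore] -/
theorem continuousAt_cuspCoord {a y : ℝ} (hy : |y| < a) : ContinuousAt (cuspCoord a) y :=
  (hasDerivAt_cuspCoord hy).continuousAt

end Summit.RiemannHypothesis.RiemannHypothesis.Theorems.PfPersistence

end
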